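import Literature.NumberTheory.EllipticCurves.BigRepModuleTotallySplitH1Proofs
import Literature.NumberTheory.EllipticCurves.BigRepModuleShiftedFixedPointsProofs
import Literature.NumberTheory.GaloisRepresentations.ConjugationDescent
import HarnessLib

/-!
# On `H¹(N, T ⊗ Λ^*(Ψ⁻¹))` the Frobenius `ψ` (`κψ ≠ 0`) acts as a SHIFTED endomorphism of
# `C^∞(ℤ_p, H¹(N, A))`; its fixed classes — which contain all restrictions from `G` — are FINITE when
# `H¹(N, A)` is finite (step (S3) of the finitely decomposed local term, finite case)

Topic `NumberTheory/EllipticCurves`; namespace `Literature.NumberTheory.EllipticCurves.BigGaloisRep`.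
THEOREMS ONLY (no definition, no named fact, no `sorry`). Cell `bsd-stepL`, K2 support 20495
`JSWSigmaLocalCharIdeal` (module L5, `HOME/imc-p1/g13/L5-PLAN`); seat `bsd-stepL-imc-p1` g13.

Setting: `G` topological group, `N ⊴ G` COMPACT with `κ(N) = 1` (`κ : G →ₜ* ℤ_p`), `ρ` a continuous
`ℤ_p`-linear representation on a discrete `p`-primary `A`, `M = bigRep κ ρ`, `ψ ∈ G` with `κψ = c`. The
tree's totally split isomorphism (defn-ty1 L2, `BigRepModule.exists_linearEquiv_h1_bigRep_of_forall_eq_one`,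
applied to `N`): `e : H¹(N, M) ≃ₗ[Λ] C^∞(ℤ_p, H¹(N, A))`, `(e[c])(x) = [d ↦ c(d)(x)]`. Under `e`, the
conjugation action `conjMap ψ` of the tree (`(ψ·z)(n) = ψ·z(ψ⁻¹nψ)`, `ContinuousCorestriction`) becomes
`Φ ↦ F'(Φ(· − c))` with `F' = conjMap ψ` on `H¹(N, A)` (`conjMap_bigRep_eq_shift`). Hence:

* **`finite_setOf_conjMap_bigRep_eq_self`** — if `H¹(N, A)` is finite and `κψ ≠ 0`, the `ψ`-fixed
  classes `{y ∈ H¹(N, M) | ψ·y = y}` form a finite set (`BigRepModule.eq_of_forall_apply_natCast_eq_of_fixed`);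
* `resSubgroup_mem_setOf_conjMap_eq_self` — every restriction `res_N(x)`, `x ∈ H¹(G, M)`, is `ψ`-fixed
  (`conjMap_resSubgroup_one`).

So at a finitely decomposed place with `H¹(I_w, E[p^∞])` finite (additive reduction) the `Λ`-submodule
`L' = ker(conjMap ψ − 1) ≤ H¹(I_w, M)` of the Greenberg–Vatsal frame
(`moduleFinite_isTorsion_mem_charIdeal_dual_h1_of_finite_ker_res`) is FINITE, so its dual is finitely
generated torsion with `Ch = ⊤`.

References: [GreenbergVatsal2000] Prop. 2.4; [PollackWeston2011] Lemma 3.2; [SkinnerUrban2014] §3.1.2,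
Prop. 3.2.3; [SerreLocalFields1979] VII §5 (the action of `G/H` on `Hⁿ(H, ·)`).
-/

noncomputable section

open scoped Classical

open CategoryTheory Multiplicative

universe u

namespace Literature.NumberTheory.EllipticCurves.BigGaloisRep

open Literature.NumberTheory.GaloisRepresentations BigRepModule

variable {p : ℕ} [hp : Fact p.Prime] {A : Type u} [AddCommGroup A] [Module ℤ_[p] A]
  [TopologicalSpace A] [DiscreteTopology A] [ContinuousSMul ℤ_[p] A]
  {G : Type u} [Group G] [TopologicalSpace G] [IsTopologicalGroup G]
  [TopologicalSpace (PowerSeries ℤ_[p])] [ContinuousSMul (PowerSeries ℤ_[p]) (BigRepModule ℤ_[p] p A)]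
  (κ : G →ₜ* Multiplicative ℤ_[p]) (ρ : ContinuousRep G ℤ_[p] A) (N : Subgroup G) [N.Normal]
  [CompactSpace N]

omit [ContinuousSMul ℤ_[p] A] [CompactSpace N] in
/-- Restrictions are fixed by the conjugation action (`conjMap_resSubgroup_one`). [cite: SerreGaloisCohomology1997, I §2.6] -/
theorem resSubgroup_mem_setOf_conjMap_eq_self (ψ : G)
    (x : continuousCohomology 1 (bigRep κ ρ).toTopRep) :
    resSubgroup (bigRep κ ρ).toTopRep N 1 x ∈
      {y : continuousCohomology 1 (subgroupRep (bigRep κ ρ).toTopRep N) |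
        conjMap (bigRep κ ρ).toTopRep N ψ 1 y = y} :=
  conjMap_resSubgroup_one (bigRep κ ρ).toTopRep N ψ x

/-- **The `ψ`-fixed classes of `H¹(N, M)` are finite** for `M = bigRep κ ρ`, `N ⊴ G` compact with
`κ(N) = 1`, `κψ ≠ 0`, `A` discrete `p`-primary with `H¹(N, A)` FINITE: under the totally split
isomorphism `H¹(N, M) ≅ C^∞(ℤ_p, H¹(N, A))` the conjugation by `ψ` is the shifted endomorphism
`Φ ↦ ψ·Φ(· − κψ)`, whose fixed points are determined by finitely many values.
[cite: GreenbergVatsal2000, Prop. 2.4] [cite: SkinnerUrban2014, Prop. 3.2.3] -/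
theorem finite_setOf_conjMap_bigRep_eq_self (hκN : ∀ n ∈ N, κ n = 1) {ψ : G}
    (hψ : (κ ψ).toAdd ≠ 0) (hA : ∀ a : A, ∃ k : ℕ, p ^ k • a = 0)
    [Finite (continuousCohomology 1 (subgroupRep ρ.toTopRep N))] :
    Set.Finite {y : continuousCohomology 1 (subgroupRep (bigRep κ ρ).toTopRep N) |
      conjMap (bigRep κ ρ).toTopRep N ψ 1 y = y} := by
  -- the restricted data: `κ|_N = 1`, `ρ|_N`; the models agree definitionally
  set κN : N →ₜ* Multiplicative ℤ_[p] := κ.comp (subgroupSubtypeHom N) with hκNdef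
  set ρN : ContinuousRep N ℤ_[p] A := ρ.restrict (subgroupSubtypeHom N) with hρNdef
  have hκN' : ∀ d : N, κN d = 1 := fun d => hκN d d.2
  have hX : (bigRep κN ρN).toTopRep = subgroupRep (bigRep κ ρ).toTopRep N := rfl
  have hY : ρN.toTopRep = subgroupRep ρ.toTopRep N := rfl
  -- the totally split isomorphism for `N`
  obtain ⟨e, he⟩ := exists_linearEquiv_h1_bigRep_of_forall_eq_one κN ρN hκN' hA
  set X := (bigRep κ ρ).toTopRep with hXdef
  set c : ℤ_[p] := (κ ψ).toAdd with hc
  set F' : continuousCohomology 1 (subgroupRep ρ.toTopRep N) →ₗ[ℤ_[p]]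
      continuousCohomology 1 (subgroupRep ρ.toTopRep N) := (conjMap ρ.toTopRep N ψ 1).hom.toLinearMap
    with hF'
  -- transport `e` to the `subgroupRep` model (definitional)
  let e' : continuousCohomology 1 (subgroupRep X N) ≃ₗ[PowerSeries ℤ_[p]]
      BigRepModule ℤ_[p] p (continuousCohomology 1 (subgroupRep ρ.toTopRep N)) := e
  have he' : ∀ (cz : contOneCocycles (subgroupRep X N)) (x : ℤ_[p])
      (z : contOneCocycles (subgroupRep ρ.toTopRep N)),
      (∀ d : N, z.1 d = (cz.1 d : BigRepModule ℤ_[p] p A) x) →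
        e' (oneCocycleClass _ cz) x = oneCocycleClass (subgroupRep ρ.toTopRep N) z :=
    fun cz x z hz => he cz x z hz
  -- under `e'`, conjugation by `ψ` is the shifted endomorphism `Φ ↦ F'(Φ(· − c))`
  have hshift : ∀ y : continuousCohomology 1 (subgroupRep X N),
      e' (conjMap X N ψ 1 y) = mapRange F' (translate (-c) (e' y)) := by
    intro y
    obtain ⟨cz, rfl⟩ := oneCocycleClass_surjective (subgroupRep X N) y
    apply BigRepModule.ext
    intro x
    -- evaluation cocycle of `cz` at `x - c`, and its conjugate
    obtain ⟨z₀, hz₀⟩ := exists_contOneCocycles_eval κN ρN hκN' cz (x - c)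
    set z' : contOneCocycles (subgroupRep ρ.toTopRep N) :=
      contOneCocycles.pullback (subgroupConj N ψ) (conjRepHom ρ.toTopRep N ψ) z₀ with hz'
    have hz'eval : ∀ d : N, z'.1 d =
        ((contOneCocycles.pullback (subgroupConj N ψ) (conjRepHom X N ψ) cz).1 d :
          BigRepModule ℤ_[p] p A) x := by
      intro d
      rw [hz', conj_pullback_apply, conj_pullback_apply, hz₀]
      rfl
    -- left-hand side
    rw [conjMap_oneCocycleClass, he' _ x z' hz'eval]
    -- right-hand side
    rw [mapRange_apply, BigRepModule.translate_apply, ← sub_eq_add_neg, he' cz (x - c) z₀ hz₀, hF']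
    change _ = (conjMap ρ.toTopRep N ψ 1) (oneCocycleClass (subgroupRep ρ.toTopRep N) z₀)
    rw [conjMap_oneCocycleClass]
  -- fixed classes inject into the fixed points of the shifted endomorphism, a finite set
  have hfix := BigRepModule.finite_setOf_fixed_shift (p := p) F' hψ
  haveI := hfix.to_subtype
  let key : {y : continuousCohomology 1 (subgroupRep X N) | conjMap X N ψ 1 y = y} →
      {Φ : BigRepModule ℤ_[p] p (continuousCohomology 1 (subgroupRep ρ.toTopRep N)) |
        ∀ x, F' (Φ (x - c)) = Φ x} :=
    fun y => ⟨e' y.1, fun x => by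
      have h := congrArg (fun Φ : BigRepModule ℤ_[p] p (continuousCohomology 1 (subgroupRep ρ.toTopRep N)) => Φ x)
        (hshift y.1)
      simp only [mapRange_apply, BigRepModule.translate_apply, ← sub_eq_add_neg] at h
      rw [← h]
      exact congrArg (fun w => e' w x) y.2⟩
  haveI : Finite {y : continuousCohomology 1 (subgroupRep X N) | conjMap X N ψ 1 y = y} :=
    Finite.of_injective key fun y y' h => Subtype.ext (e'.injective (congrArg Subtype.val h))
  exact Set.toFinite _

end Literature.NumberTheory.EllipticCurves.BigGaloisRep

end
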